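import Literature.MathematicalPhysics.QuantumLattice.HubbardModel
import Mathlib.Tactic.Module
import Mathlib.Tactic.NoncommRing
import HarnessLib

/-!
# Koma–Tasaki's gauge-transformation bound for the Hubbard model

Trunk T-QLATTICE (family `hubbard`; consumer: `Literature.MathematicalPhysics.QuantumLattice.koma_tasaki_2d`). We carry out, for
the Hubbard model `hamiltonianWith G t U μ` on an arbitrary finite graph `G`, the model-specific
part of Koma–Tasaki's proof (PRL 68 (1992) 3248, eqs. (5)–(12)):

* `gaugeMatrix θ` — the non-unitary `U(1)` gauge transformation
  `G(-iθ) = exp[-Σ_i θ_i n_i]` (Koma–Tasaki eq. (5) with imaginary angles), realised as the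
  explicit diagonal matrix `|s⟩ ↦ e^{-Σ_{i ∈ s} θ_i} |s⟩` of the occupation basis, with
  `G c_i G⁻¹ = e^{θ_i} c_i`, `G c†_i G⁻¹ = e^{-θ_i} c†_i` (eq. (8));
* `hoppingForm G w = Σ_{x ∼ y, σ} w(x, y) c†_{xσ} c_{yσ}` — hopping operators with bond weights,
  their adjoints, gauge transforms (eq. (7)) and the norm bound `‖·‖ ≤ Σ 2|w|`
  (`‖c†_{uσ} c_{vσ}‖ ≤ 1`);
* `isHermitian_hamiltonianWith` — the grand-canonical Hubbard Hamiltonian is Hermitian;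
* `siteGauge_mul_pair_mul` (eq. (8): the pair operator `c†_{x↑} c†_{x↓} c_{y↓} c_{y↑}` is an
  eigenvector of the gauge conjugation with eigenvalue `e^{-2(φ_x - φ_y)}`),
  `siteGauge_conj_hamiltonianWith_add_conjTranspose` (eq. (9): `K + Kᴴ = 2(H + V_φ)` for
  `K = G H G⁻¹`, `V_φ = -t T(cosh(φ_u - φ_v) - 1)`) and `norm_hoppingPerturbation_le`
  (`‖V_φ‖ ≤ |t| Σ_{u ∼ v} 2 (cosh(φ_u - φ_v) - 1)`, first bound of eq. (11)) — the three inputs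
  of the abstract trace bound; the a priori bound on `⟨c†c†cc⟩_β` itself is assembled in
  `HubbardHubbardModelPairDecayProofs.lean` (it needs the Golden–Thompson chain).

Sources: T. Koma, H. Tasaki, PRL 68 (1992) 3248; O. A. McBryan, T. Spencer, Commun. Math. Phys.
53 (1977) 299.

## Mathlib search

Mathlib has no fermionic Fock space; the concrete matrix model of the prelude
(`Literature.MathematicalPhysics.QuantumLattice.annihilation`, `creation`, `hamiltonian`, `Literature.MathematicalPhysics.QuantumLattice.hamiltonianWith`,
`numberAt_eq_diagonal`) is reused. Matrix API used: `Matrix.diagonal_mul`, `Matrix.mul_diagonal`,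
`Matrix.l2_opNorm_diagonal`, `Matrix.l2_opNorm_conjTranspose_mul_self`, `Matrix.inv_eq_right_inv`.

## Design notes

The gauge transformation is written as an explicit diagonal matrix rather than as
`exp (-Σ θ_i n_i)`, which makes eq. (8) an entrywise computation and avoids the CAR. The site
potential `φ : Λ → ℝ` enters through the orbital potential `θ (x, σ) = φ x`.
-/

noncomputable section

namespace Literature.MathematicalPhysics.QuantumLattice

open Matrix Finset NormedSpace
open scoped Matrix.Norms.L2Operator ComplexOrder

/-! ### The gauge transformation on Fock space -/

section Gauge

variable {ι : Type*} [LinearOrder ι]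

/-- Koma–Tasaki's non-unitary gauge transformation `G(-iθ) = exp[-Σ_i θ_i n_i]` on the fermionic
Fock space, as the diagonal matrix `|s⟩ ↦ e^{-Σ_{i ∈ s} θ_i} |s⟩` in the occupation basis.
Koma–Tasaki, PRL 68 (1992) 3248, eq. (5) (with `θ_u ↦ -iθ_u`). [cite: KomaTasakiPRL1992, eq. (5)] -/
def gaugeMatrix (θ : ι → ℝ) : Matrix (Finset ι) (Finset ι) ℂ :=
  diagonal fun s => ((Real.exp (-∑ i ∈ s, θ i) : ℝ) : ℂ)

/-- `gaugeMatrix θ` unfolded. Koma–Tasaki, PRL 68 (1992) 3248, eq. (5). [folklore] -/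
theorem gaugeMatrix_eq (θ : ι → ℝ) :
    gaugeMatrix θ = diagonal fun s => ((Real.exp (-∑ i ∈ s, θ i) : ℝ) : ℂ) := rfl

variable [Fintype ι]

/-- `G(θ) G(-θ) = 1`. Koma–Tasaki, PRL 68 (1992) 3248, after eq. (5). [folklore] -/
theorem gaugeMatrix_mul_gaugeMatrix_neg (θ : ι → ℝ) : gaugeMatrix θ * gaugeMatrix (-θ) = 1 := by
  rw [gaugeMatrix, gaugeMatrix, diagonal_mul_diagonal, ← diagonal_one]
  congr 1
  funext s
  rw [← Complex.ofReal_mul, ← Real.exp_add]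
  simp

/-- `G(-θ) G(θ) = 1`. Koma–Tasaki, PRL 68 (1992) 3248, after eq. (5). [folklore] -/
theorem gaugeMatrix_neg_mul_gaugeMatrix (θ : ι → ℝ) : gaugeMatrix (-θ) * gaugeMatrix θ = 1 := by
  simpa using gaugeMatrix_mul_gaugeMatrix_neg (-θ)

/-- The gauge transformation is invertible ("Since `G(θ)` is invertible, …").
Koma–Tasaki, PRL 68 (1992) 3248, before eq. (6). [folklore] -/
theorem isUnit_gaugeMatrix (θ : ι → ℝ) : IsUnit (gaugeMatrix θ) :=
  ⟨⟨gaugeMatrix θ, gaugeMatrix (-θ), gaugeMatrix_mul_gaugeMatrix_neg θ,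
    gaugeMatrix_neg_mul_gaugeMatrix θ⟩, rfl⟩

/-- `G(θ)⁻¹ = G(-θ)`. Koma–Tasaki, PRL 68 (1992) 3248, before eq. (6). [folklore] -/
theorem gaugeMatrix_inv (θ : ι → ℝ) : (gaugeMatrix θ)⁻¹ = gaugeMatrix (-θ) :=
  inv_eq_right_inv (gaugeMatrix_mul_gaugeMatrix_neg θ)

omit [Fintype ι] in
/-- For imaginary angles the gauge transformation is a real diagonal, hence Hermitian, matrix.
Koma–Tasaki, PRL 68 (1992) 3248, eq. (5). [folklore] -/
theorem conjTranspose_gaugeMatrix (θ : ι → ℝ) : (gaugeMatrix θ)ᴴ = gaugeMatrix θ := by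
  rw [gaugeMatrix, diagonal_conjTranspose]
  congr 1
  funext s
  simp only [Pi.star_apply, Complex.star_def, Complex.conj_ofReal]

/-- **Koma–Tasaki eq. (8) for a single annihilation operator**: `G(θ) c_j G(θ)⁻¹ = e^{θ_j} c_j`
(the matrix element `⟨s| c_j |s ∪ {j}⟩` picks up `e^{-Σ_s θ} e^{Σ_s θ + θ_j}`).
Koma–Tasaki, PRL 68 (1992) 3248, eqs. (7)–(8). [cite: KomaTasakiPRL1992, eqs. (7)–(8)] -/
theorem gaugeMatrix_mul_annihilation_mul (θ : ι → ℝ) (j : ι) :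
    gaugeMatrix θ * annihilation j * gaugeMatrix (-θ) =
      ((Real.exp (θ j) : ℝ) : ℂ) • annihilation j := by
  ext s t
  simp only [gaugeMatrix, diagonal_mul, mul_diagonal, Matrix.smul_apply, smul_eq_mul, annihilation,
    Pi.neg_apply, sum_neg_distrib, neg_neg]
  split_ifs with h
  · rw [h.2, sum_insert h.1]
    have : ((Real.exp (-∑ i ∈ s, θ i) : ℝ) : ℂ) * jwSign j s *
        ((Real.exp (θ j + ∑ i ∈ s, θ i) : ℝ) : ℂ) =
        ((Real.exp (-∑ i ∈ s, θ i) * Real.exp (θ j + ∑ i ∈ s, θ i) : ℝ) : ℂ) * jwSign j s := by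
      push_cast; ring
    rw [this, ← Real.exp_add]
    congr 2
    ring_nf
  · simp

/-- **Koma–Tasaki eq. (8) for a single creation operator**: `G(θ) c†_j G(θ)⁻¹ = e^{-θ_j} c†_j`.
Koma–Tasaki, PRL 68 (1992) 3248, eqs. (7)–(8). [cite: KomaTasakiPRL1992, eqs. (7)–(8)] -/
theorem gaugeMatrix_mul_creation_mul (θ : ι → ℝ) (j : ι) :
    gaugeMatrix θ * creation j * gaugeMatrix (-θ) =
      ((Real.exp (-θ j) : ℝ) : ℂ) • creation j := by
  have h := congrArg conjTranspose (gaugeMatrix_mul_annihilation_mul (-θ) j)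
  rw [conjTranspose_mul, conjTranspose_mul, neg_neg, conjTranspose_gaugeMatrix,
    conjTranspose_gaugeMatrix, annihilation_conjTranspose, conjTranspose_smul,
    annihilation_conjTranspose, ← mul_assoc] at h
  rw [h]
  simp only [Pi.neg_apply, Complex.star_def, Complex.conj_ofReal]

/-- Conjugation by the gauge transformation is multiplicative. [folklore] -/
theorem gaugeMatrix_conj_mul (θ : ι → ℝ) (X Y : Matrix (Finset ι) (Finset ι) ℂ) :
    gaugeMatrix θ * (X * Y) * gaugeMatrix (-θ) =
      gaugeMatrix θ * X * gaugeMatrix (-θ) * (gaugeMatrix θ * Y * gaugeMatrix (-θ)) := by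
  calc gaugeMatrix θ * (X * Y) * gaugeMatrix (-θ)
      = gaugeMatrix θ * X * (gaugeMatrix (-θ) * gaugeMatrix θ) * Y * gaugeMatrix (-θ) := by
        rw [gaugeMatrix_neg_mul_gaugeMatrix]; noncomm_ring
    _ = gaugeMatrix θ * X * gaugeMatrix (-θ) * (gaugeMatrix θ * Y * gaugeMatrix (-θ)) := by
        noncomm_ring

/-- Number operators are gauge invariant: `G(θ) n_j G(θ)⁻¹ = n_j`.
Koma–Tasaki, PRL 68 (1992) 3248, eq. (7). [cite: KomaTasakiPRL1992, eq. (7)] -/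
theorem gaugeMatrix_mul_numberAt_mul (θ : ι → ℝ) (j : ι) :
    gaugeMatrix θ * numberAt j * gaugeMatrix (-θ) = numberAt j := by
  rw [numberAt, gaugeMatrix_conj_mul, gaugeMatrix_mul_creation_mul,
    gaugeMatrix_mul_annihilation_mul, smul_mul_smul, ← Complex.ofReal_mul, ← Real.exp_add]
  simp

/-! ### Operator norms of the fermion operators -/

/-- `‖c_j‖ ≤ 1` in operator norm: `‖c_j‖² = ‖c†_j c_j‖ = ‖n_j‖ ≤ 1`, `n_j` being a diagonal
`0/1` matrix. Koma–Tasaki, PRL 68 (1992) 3248, after eq. (11) (`‖c†c + h.c.‖ = 1`). [folklore] -/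
theorem norm_annihilation_le_one (j : ι) :
    ‖(annihilation j : Matrix (Finset ι) (Finset ι) ℂ)‖ ≤ 1 := by
  have hn : ‖(numberAt j : Matrix (Finset ι) (Finset ι) ℂ)‖ ≤ 1 := by
    rw [numberAt_eq_diagonal, l2_opNorm_diagonal, pi_norm_le_iff_of_nonneg zero_le_one]
    intro s
    split_ifs <;> simp
  have hsq : ‖(annihilation j : Matrix (Finset ι) (Finset ι) ℂ)‖ *
      ‖(annihilation j : Matrix (Finset ι) (Finset ι) ℂ)‖ ≤ 1 := by
    rw [← l2_opNorm_conjTranspose_mul_self, annihilation_conjTranspose]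
    exact hn
  nlinarith [norm_nonneg (annihilation j : Matrix (Finset ι) (Finset ι) ℂ)]

/-- `‖c†_j‖ ≤ 1` in operator norm. Koma–Tasaki, PRL 68 (1992) 3248, after eq. (11). [folklore] -/
theorem norm_creation_le_one (j : ι) : ‖(creation j : Matrix (Finset ι) (Finset ι) ℂ)‖ ≤ 1 := by
  rw [creation, l2_opNorm_conjTranspose]
  exact norm_annihilation_le_one j

end Gauge

/-! ### Site potentials, hopping operators and the Hubbard Hamiltonian -/

section Hamiltonian

variable {Λ : Type*} [LinearOrder Λ] [Fintype Λ]

/-- The gauge transformation generated by a *site* potential `φ : Λ → ℝ` acting alike on both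
spin orbitals, `G(-iφ) = exp[-Σ_u φ_u (n_{u↑} + n_{u↓})]`, i.e. `gaugeMatrix` of the orbital
potential `(u, σ) ↦ φ_u`. Koma–Tasaki, PRL 68 (1992) 3248, eq. (5) (`n_u = n_{u↑} + n_{u↓}`,
imaginary angles `θ_u = -iφ_u` as chosen after eq. (7)). [cite: KomaTasakiPRL1992, eq. (5)] -/
def siteGauge (φ : Λ → ℝ) : Matrix (Finset (Orb Λ)) (Finset (Orb Λ)) ℂ :=
  gaugeMatrix fun o : Orb Λ => φ (ofLex o).1

omit [Fintype Λ] in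
/-- `siteGauge φ` is `gaugeMatrix` of the orbital potential `(u, σ) ↦ φ u`.
Koma–Tasaki, PRL 68 (1992) 3248, eq. (5). [folklore] -/
theorem siteGauge_eq (φ : Λ → ℝ) :
    siteGauge φ = gaugeMatrix fun o : Orb Λ => φ (ofLex o).1 := rfl

omit [Fintype Λ] in
/-- `siteGauge (-φ)` is `gaugeMatrix` of the negated orbital potential. [folklore] -/
theorem siteGauge_neg (φ : Λ → ℝ) :
    siteGauge (-φ) = gaugeMatrix (-fun o : Orb Λ => φ (ofLex o).1) := rfl

/-- `G(φ) G(-φ) = 1` for site potentials. Koma–Tasaki, PRL 68 (1992) 3248, after eq. (5).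
[folklore] -/
theorem siteGauge_mul_siteGauge_neg (φ : Λ → ℝ) : siteGauge φ * siteGauge (-φ) = 1 := by
  rw [siteGauge_neg, siteGauge_eq, gaugeMatrix_mul_gaugeMatrix_neg]

/-- `G(-φ) G(φ) = 1` for site potentials. Koma–Tasaki, PRL 68 (1992) 3248, after eq. (5).
[folklore] -/
theorem siteGauge_neg_mul_siteGauge (φ : Λ → ℝ) : siteGauge (-φ) * siteGauge φ = 1 := by
  rw [siteGauge_neg, siteGauge_eq, gaugeMatrix_neg_mul_gaugeMatrix]

/-- The site gauge transformation is invertible. Koma–Tasaki, PRL 68 (1992) 3248, before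
eq. (6). [folklore] -/
theorem isUnit_siteGauge (φ : Λ → ℝ) : IsUnit (siteGauge φ) :=
  isUnit_gaugeMatrix _

/-- `G(φ)⁻¹ = G(-φ)` for site potentials. Koma–Tasaki, PRL 68 (1992) 3248, before eq. (6).
[folklore] -/
theorem siteGauge_inv (φ : Λ → ℝ) : (siteGauge φ)⁻¹ = siteGauge (-φ) := by
  rw [siteGauge_eq, gaugeMatrix_inv, siteGauge_neg]

/-- Eq. (8) for site potentials: `G(φ) c_{uσ} G(φ)⁻¹ = e^{φ_u} c_{uσ}`.
Koma–Tasaki, PRL 68 (1992) 3248, eq. (8). [cite: KomaTasakiPRL1992, eq. (8)] -/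
theorem siteGauge_mul_annihilation_mul (φ : Λ → ℝ) (u : Λ) (σ : Fin 2) :
    siteGauge φ * annihilation (orb u σ) * siteGauge (-φ) =
      ((Real.exp (φ u) : ℝ) : ℂ) • annihilation (orb u σ) := by
  rw [siteGauge_neg, siteGauge_eq, gaugeMatrix_mul_annihilation_mul]
  rfl

/-- Eq. (8) for site potentials: `G(φ) c†_{uσ} G(φ)⁻¹ = e^{-φ_u} c†_{uσ}`.
Koma–Tasaki, PRL 68 (1992) 3248, eq. (8). [cite: KomaTasakiPRL1992, eq. (8)] -/
theorem siteGauge_mul_creation_mul (φ : Λ → ℝ) (u : Λ) (σ : Fin 2) :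
    siteGauge φ * creation (orb u σ) * siteGauge (-φ) =
      ((Real.exp (-φ u) : ℝ) : ℂ) • creation (orb u σ) := by
  rw [siteGauge_neg, siteGauge_eq, gaugeMatrix_mul_creation_mul]
  rfl

/-- Conjugation by the site gauge transformation is multiplicative. [folklore] -/
theorem siteGauge_conj_mul (φ : Λ → ℝ) (X Y : Matrix (Finset (Orb Λ)) (Finset (Orb Λ)) ℂ) :
    siteGauge φ * (X * Y) * siteGauge (-φ) =
      siteGauge φ * X * siteGauge (-φ) * (siteGauge φ * Y * siteGauge (-φ)) := by
  rw [siteGauge_neg, siteGauge_eq, gaugeMatrix_conj_mul]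

/-- The Hubbard number operators are gauge invariant: `G(φ) n_{uσ} G(φ)⁻¹ = n_{uσ}`.
Koma–Tasaki, PRL 68 (1992) 3248, eq. (7). [cite: KomaTasakiPRL1992, eq. (7)] -/
theorem siteGauge_mul_numberOp_mul (φ : Λ → ℝ) (u : Λ) (σ : Fin 2) :
    siteGauge φ * numberOp u σ * siteGauge (-φ) = numberOp u σ := by
  rw [← numberAt_orb, siteGauge_neg, siteGauge_eq, gaugeMatrix_mul_numberAt_mul]

/-- **Koma–Tasaki eq. (8)**: the pair operator `c†_{x↑} c†_{x↓} c_{y↓} c_{y↑}` is an eigenvector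
of the gauge conjugation, `G(φ) A G(φ)⁻¹ = e^{-2(φ_x - φ_y)} A`.
Koma–Tasaki, PRL 68 (1992) 3248, eq. (8). [cite: KomaTasakiPRL1992, eq. (8)] -/
theorem siteGauge_mul_pair_mul (φ : Λ → ℝ) (x y : Λ) :
    siteGauge φ * (creation (orb x 0) * creation (orb x 1) *
        (annihilation (orb y 1) * annihilation (orb y 0))) * siteGauge (-φ) =
      ((Real.exp (-2 * (φ x - φ y)) : ℝ) : ℂ) •
        (creation (orb x 0) * creation (orb x 1) *
          (annihilation (orb y 1) * annihilation (orb y 0))) := by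
  rw [siteGauge_conj_mul, siteGauge_conj_mul, siteGauge_conj_mul φ (annihilation _),
    siteGauge_mul_creation_mul, siteGauge_mul_creation_mul, siteGauge_mul_annihilation_mul,
    siteGauge_mul_annihilation_mul, smul_mul_smul, smul_mul_smul, smul_mul_smul]
  congr 1
  rw [← Complex.ofReal_mul, ← Complex.ofReal_mul, ← Complex.ofReal_mul, ← Real.exp_add,
    ← Real.exp_add, ← Real.exp_add]
  congr 2
  ring

/-- `‖c†_{x↑} c†_{x↓} c_{y↓} c_{y↑}‖ ≤ 1` (Koma–Tasaki use `‖A‖ = 1` in the second bound of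
eq. (10)). Koma–Tasaki, PRL 68 (1992) 3248, proof of eq. (10). [folklore] -/
theorem norm_pair_le_one (x y : Λ) :
    ‖(creation (orb x 0) * creation (orb x 1) *
        (annihilation (orb y 1) * annihilation (orb y 0)) :
          Matrix (Finset (Orb Λ)) (Finset (Orb Λ)) ℂ)‖ ≤ 1 := by
  refine (norm_mul_le _ _).trans (mul_le_one₀ ((norm_mul_le _ _).trans ?_) (norm_nonneg _)
    ((norm_mul_le _ _).trans ?_))
  · exact mul_le_one₀ (norm_creation_le_one _) (norm_nonneg _) (norm_creation_le_one _)
  · exact mul_le_one₀ (norm_annihilation_le_one _) (norm_nonneg _)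
      (norm_annihilation_le_one _)

variable (G : SimpleGraph Λ) [DecidableRel G.Adj]

/-- The hopping operator with real bond weights `w`,
`T(w) = Σ_{u ∼ v} Σ_σ w(u, v) c†_{uσ} c_{vσ}` (sum over ordered adjacent pairs of `G`); the
Hubbard hopping term is `-t T(1)`, its gauge transform is `-t T(e^{φ_v - φ_u})`
(Koma–Tasaki's `cos(θ_x - θ_y) c†c + …` of eq. (7) at imaginary angles).
Koma–Tasaki, PRL 68 (1992) 3248, eqs. (1), (7). [cite: KomaTasakiPRL1992, eqs. (1) and (7)] -/
def hoppingForm (w : Λ → Λ → ℝ) : Matrix (Finset (Orb Λ)) (Finset (Orb Λ)) ℂ :=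
  ∑ u : Λ, ∑ v : Λ, ∑ σ : Fin 2,
    if G.Adj u v then ((w u v : ℝ) : ℂ) • (creation (orb u σ) * annihilation (orb v σ)) else 0

/-- `hoppingForm` unfolded. Koma–Tasaki, PRL 68 (1992) 3248, eq. (1). [folklore] -/
theorem hoppingForm_eq (w : Λ → Λ → ℝ) :
    hoppingForm G w = ∑ u : Λ, ∑ v : Λ, ∑ σ : Fin 2,
      if G.Adj u v then ((w u v : ℝ) : ℂ) • (creation (orb u σ) * annihilation (orb v σ))
      else 0 := rfl

/-- `hoppingForm` is additive in the bond weights. [folklore] -/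
theorem hoppingForm_add (w w' : Λ → Λ → ℝ) :
    hoppingForm G w + hoppingForm G w' = hoppingForm G fun u v => w u v + w' u v := by
  simp only [hoppingForm, ← Finset.sum_add_distrib]
  refine Finset.sum_congr rfl fun u _ => Finset.sum_congr rfl fun v _ =>
    Finset.sum_congr rfl fun σ _ => ?_
  split_ifs
  · rw [← add_smul, ← Complex.ofReal_add]
  · rw [add_zero]

/-- `hoppingForm` is homogeneous in the bond weights. [folklore] -/
theorem smul_hoppingForm (c : ℝ) (w : Λ → Λ → ℝ) :
    (c : ℂ) • hoppingForm G w = hoppingForm G fun u v => c * w u v := by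
  simp only [hoppingForm, Finset.smul_sum]
  refine Finset.sum_congr rfl fun u _ => Finset.sum_congr rfl fun v _ =>
    Finset.sum_congr rfl fun σ _ => ?_
  split_ifs
  · rw [smul_smul, ← Complex.ofReal_mul]
  · rw [smul_zero]

/-- The Hubbard hopping term is `-t T(1)`: `Σ_{u ∼ v, σ} c†_{uσ} c_{vσ} = hoppingForm G 1`.
Koma–Tasaki, PRL 68 (1992) 3248, eq. (1). [folklore] -/
theorem hoppingForm_one :
    hoppingForm G (fun _ _ => 1) =
      ∑ u : Λ, ∑ v : Λ, ∑ σ : Fin 2,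
        if G.Adj u v then creation (orb u σ) * annihilation (orb v σ) else 0 := by
  simp [hoppingForm]

/-- The adjoint of a hopping operator is the hopping operator of the transposed weights,
`T(w)ᴴ = T(wᵀ)` (`(c†_{uσ} c_{vσ})ᴴ = c†_{vσ} c_{uσ}` and `G.Adj` is symmetric).
Koma–Tasaki, PRL 68 (1992) 3248, eq. (1) ("h.c."). [folklore] -/
theorem hoppingForm_conjTranspose (w : Λ → Λ → ℝ) :
    (hoppingForm G w)ᴴ = hoppingForm G fun u v => w v u := by
  simp only [hoppingForm, conjTranspose_sum]
  rw [Finset.sum_comm]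
  refine Finset.sum_congr rfl fun u _ => Finset.sum_congr rfl fun v _ =>
    Finset.sum_congr rfl fun σ _ => ?_
  by_cases h : G.Adj u v
  · rw [if_pos h, if_pos (G.adj_symm h), conjTranspose_smul, conjTranspose_mul,
      creation_conjTranspose, annihilation_conjTranspose]
    simp only [Complex.star_def, Complex.conj_ofReal]
  · rw [if_neg h, if_neg (fun h' => h (G.adj_symm h')), conjTranspose_zero]

/-- A hopping operator with symmetric weights is Hermitian. [folklore] -/
theorem isHermitian_hoppingForm {w : Λ → Λ → ℝ} (hw : ∀ u v, w u v = w v u) :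
    (hoppingForm G w).IsHermitian := by
  rw [IsHermitian, hoppingForm_conjTranspose]
  congr 1
  funext u v
  exact (hw u v).symm

/-- **Koma–Tasaki eq. (7)** (hopping part): the gauge transform of a hopping operator rescales
the bond weights, `G(φ) T(w) G(φ)⁻¹ = T(w(u,v) e^{φ_v - φ_u})`.
Koma–Tasaki, PRL 68 (1992) 3248, eq. (7). [cite: KomaTasakiPRL1992, eq. (7)] -/
theorem siteGauge_mul_hoppingForm_mul (φ : Λ → ℝ) (w : Λ → Λ → ℝ) :
    siteGauge φ * hoppingForm G w * siteGauge (-φ) =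
      hoppingForm G fun u v => w u v * Real.exp (φ v - φ u) := by
  simp only [hoppingForm, Finset.mul_sum, Finset.sum_mul]
  refine Finset.sum_congr rfl fun u _ => Finset.sum_congr rfl fun v _ =>
    Finset.sum_congr rfl fun σ _ => ?_
  split_ifs with h
  · rw [Matrix.mul_smul, Matrix.smul_mul, siteGauge_conj_mul, siteGauge_mul_creation_mul,
      siteGauge_mul_annihilation_mul, smul_mul_smul, smul_smul]
    congr 1
    rw [← Complex.ofReal_mul, ← Complex.ofReal_mul, ← Real.exp_add, sub_eq_neg_add]
  · rw [Matrix.mul_zero, Matrix.zero_mul]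

/-- Norm bound for hopping operators: `‖T(w)‖ ≤ Σ_{u ∼ v} 2 |w(u, v)|`
(`‖c†_{uσ} c_{vσ}‖ ≤ 1`, two spin values). Koma–Tasaki, PRL 68 (1992) 3248, first bound of
eq. (11) ("where we have used `‖c†_{uσ} c_{vσ} + c†_{vσ} c_{uσ}‖ = 1`"). [folklore] -/
theorem norm_hoppingForm_le (w : Λ → Λ → ℝ) :
    ‖hoppingForm G w‖ ≤ ∑ u : Λ, ∑ v : Λ, if G.Adj u v then 2 * |w u v| else 0 := by
  rw [hoppingForm]
  refine (norm_sum_le _ _).trans (Finset.sum_le_sum fun u _ => ?_)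
  refine (norm_sum_le _ _).trans (Finset.sum_le_sum fun v _ => ?_)
  by_cases h : G.Adj u v
  · simp only [if_pos h]
    refine (norm_sum_le _ _).trans ?_
    have hterm : ∀ σ : Fin 2,
        ‖((w u v : ℝ) : ℂ) • (creation (orb u σ) * annihilation (orb v σ) :
          Matrix (Finset (Orb Λ)) (Finset (Orb Λ)) ℂ)‖ ≤ |w u v| := by
      intro σ
      rw [norm_smul, Complex.norm_real, Real.norm_eq_abs]
      exact mul_le_of_le_one_right (abs_nonneg _) ((norm_mul_le _ _).trans
        (mul_le_one₀ (norm_creation_le_one _) (norm_nonneg _) (norm_annihilation_le_one _)))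
    calc ∑ σ : Fin 2, ‖((w u v : ℝ) : ℂ) • (creation (orb u σ) * annihilation (orb v σ) :
            Matrix (Finset (Orb Λ)) (Finset (Orb Λ)) ℂ)‖
        ≤ ∑ _σ : Fin 2, |w u v| := Finset.sum_le_sum fun σ _ => hterm σ
      _ = 2 * |w u v| := by simp [two_mul]
  · simp [h]

/-- The gauge-invariant part of the grand-canonical Hubbard Hamiltonian: on-site interaction and
chemical potential, `U Σ_u n_{u↑} n_{u↓} - μ N`. Koma–Tasaki, PRL 68 (1992) 3248, eqs. (1), (7).
[cite: KomaTasakiPRL1992, eqs. (1) and (7)] -/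
def densityTerms (U μ : ℝ) : Matrix (Finset (Orb Λ)) (Finset (Orb Λ)) ℂ :=
  (U : ℂ) • (∑ u : Λ, numberOp u 0 * numberOp u 1) - (μ : ℂ) • totalNumber

/-- `densityTerms` unfolded. Koma–Tasaki, PRL 68 (1992) 3248, eq. (1). [folklore] -/
theorem densityTerms_eq (U μ : ℝ) :
    (densityTerms U μ : Matrix (Finset (Orb Λ)) (Finset (Orb Λ)) ℂ) =
      (U : ℂ) • (∑ u : Λ, numberOp u 0 * numberOp u 1) - (μ : ℂ) • totalNumber := rfl

/-- The grand-canonical Hubbard Hamiltonian is `-t T(1) +` (density terms).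
Koma–Tasaki, PRL 68 (1992) 3248, eq. (1). [folklore] -/
theorem hamiltonianWith_eq_hoppingForm (t U μ : ℝ) :
    hamiltonianWith G t U μ = -(t : ℂ) • hoppingForm G (fun _ _ => 1) + densityTerms U μ := by
  rw [hamiltonianWith, hamiltonian, hoppingForm_one, densityTerms, add_sub_assoc]

/-- The density terms are Hermitian (number operators are commuting Hermitian matrices).
[folklore] -/
theorem isHermitian_densityTerms (U μ : ℝ) :
    (densityTerms U μ : Matrix (Finset (Orb Λ)) (Finset (Orb Λ)) ℂ).IsHermitian := by
  have hn : ∀ (u : Λ) (σ : Fin 2), (numberOp u σ : Matrix (Finset (Orb Λ)) (Finset (Orb Λ)) ℂ)ᴴ =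
      numberOp u σ := fun u σ => (numberAt_isHermitian (orb u σ)).eq
  have hc : ∀ u : Λ, (numberOp u 1 : Matrix (Finset (Orb Λ)) (Finset (Orb Λ)) ℂ) * numberOp u 0 =
      numberOp u 0 * numberOp u 1 := fun u => (numberAt_commute (orb u 1) (orb u 0)).eq
  unfold IsHermitian densityTerms totalNumber
  simp only [conjTranspose_sub, conjTranspose_smul, conjTranspose_sum, conjTranspose_mul, hn, hc,
    Complex.star_def, Complex.conj_ofReal]

/-- The density terms are gauge invariant, `G(φ) (U Σ n n - μ N) G(φ)⁻¹ = U Σ n n - μ N`.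
Koma–Tasaki, PRL 68 (1992) 3248, eq. (7). [cite: KomaTasakiPRL1992, eq. (7)] -/
theorem siteGauge_mul_densityTerms_mul (φ : Λ → ℝ) (U μ : ℝ) :
    siteGauge φ * densityTerms U μ * siteGauge (-φ) = densityTerms U μ := by
  unfold densityTerms totalNumber
  simp only [Matrix.mul_sub, Matrix.sub_mul, Matrix.mul_smul, Matrix.smul_mul, Finset.mul_sum,
    Finset.sum_mul, siteGauge_conj_mul φ (numberOp _ 0), siteGauge_mul_numberOp_mul]

/-- The grand-canonical Hubbard Hamiltonian `H(t, U) - μ N` is Hermitian.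
Lieb, arXiv:cond-mat/9311033 §2; Koma–Tasaki, PRL 68 (1992) 3248, eq. (1). [folklore] -/
theorem isHermitian_hamiltonianWith (t U μ : ℝ) : (hamiltonianWith G t U μ).IsHermitian := by
  rw [hamiltonianWith_eq_hoppingForm]
  refine IsHermitian.add ?_ (isHermitian_densityTerms U μ)
  have h := (isHermitian_hoppingForm G (w := fun _ _ => (1 : ℝ)) fun _ _ => rfl).eq
  rw [IsHermitian, conjTranspose_smul, h]
  simp only [Complex.star_def, map_neg, Complex.conj_ofReal]

/-- **Koma–Tasaki eq. (7)**: the gauge-transformed Hamiltonian is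
`G(φ) H G(φ)⁻¹ = -t T(e^{φ_v - φ_u}) + (U Σ n n - μ N)`.
Koma–Tasaki, PRL 68 (1992) 3248, eq. (7). [cite: KomaTasakiPRL1992, eq. (7)] -/
theorem siteGauge_mul_hamiltonianWith_mul (φ : Λ → ℝ) (t U μ : ℝ) :
    siteGauge φ * hamiltonianWith G t U μ * siteGauge (-φ) =
      -(t : ℂ) • hoppingForm G (fun u v => Real.exp (φ v - φ u)) + densityTerms U μ := by
  rw [hamiltonianWith_eq_hoppingForm, Matrix.mul_add, Matrix.add_mul, Matrix.mul_smul,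
    Matrix.smul_mul, siteGauge_mul_hoppingForm_mul, siteGauge_mul_densityTerms_mul]
  simp only [one_mul]

/-- **Koma–Tasaki eq. (9)** (Hermitian part): with `K = G(φ) H G(φ)⁻¹`,
`K + Kᴴ = 2 (H + V_φ)` where `V_φ = -t T(cosh(φ_u - φ_v) - 1)` is the bounded Hermitian
perturbation `U` of eq. (9) (`e^{s} + e^{-s} = 2 + 2 (cosh s - 1)`).
Koma–Tasaki, PRL 68 (1992) 3248, eqs. (7), (9). [cite: KomaTasakiPRL1992, eqs. (7) and (9)] -/
theorem siteGauge_conj_hamiltonianWith_add_conjTranspose (φ : Λ → ℝ) (t U μ : ℝ) :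
    siteGauge φ * hamiltonianWith G t U μ * siteGauge (-φ) +
        (siteGauge φ * hamiltonianWith G t U μ * siteGauge (-φ))ᴴ =
      (2 : ℂ) • (hamiltonianWith G t U μ +
        -(t : ℂ) • hoppingForm G (fun u v => Real.cosh (φ u - φ v) - 1)) := by
  rw [siteGauge_mul_hamiltonianWith_mul, conjTranspose_add, conjTranspose_smul,
    hoppingForm_conjTranspose, (isHermitian_densityTerms U μ).eq, hamiltonianWith_eq_hoppingForm]
  have hstar : star (-(t : ℂ)) = -(t : ℂ) := by
    simp only [Complex.star_def, map_neg, Complex.conj_ofReal]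
  rw [hstar]
  have hw : hoppingForm G (fun u v => Real.exp (φ v - φ u)) +
      hoppingForm G (fun u v => Real.exp (φ u - φ v)) =
      (2 : ℂ) • hoppingForm G (fun _ _ => 1) +
        (2 : ℂ) • hoppingForm G (fun u v => Real.cosh (φ u - φ v) - 1) := by
    have h2 : ((2 : ℝ) : ℂ) = 2 := by norm_num
    rw [hoppingForm_add, ← h2, smul_hoppingForm, smul_hoppingForm, hoppingForm_add]
    congr 1
    funext u v
    rw [Real.cosh_eq, show φ v - φ u = -(φ u - φ v) by ring]
    ring
  calc -(t : ℂ) • hoppingForm G (fun u v => Real.exp (φ v - φ u)) + densityTerms U μ +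
        (-(t : ℂ) • hoppingForm G (fun u v => Real.exp (φ u - φ v)) + densityTerms U μ)
      = -(t : ℂ) • (hoppingForm G (fun u v => Real.exp (φ v - φ u)) +
          hoppingForm G (fun u v => Real.exp (φ u - φ v))) + (2 : ℂ) • densityTerms U μ := by
        rw [smul_add, two_smul]; abel
    _ = -(t : ℂ) • ((2 : ℂ) • hoppingForm G (fun _ _ => 1) +
          (2 : ℂ) • hoppingForm G (fun u v => Real.cosh (φ u - φ v) - 1)) +
          (2 : ℂ) • densityTerms U μ := by rw [hw]
    _ = (2 : ℂ) • (-(t : ℂ) • hoppingForm G (fun _ _ => 1) + densityTerms U μ +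
          -(t : ℂ) • hoppingForm G (fun u v => Real.cosh (φ u - φ v) - 1)) := by
        module

/-- The perturbation `V_φ = -t T(cosh(φ_u - φ_v) - 1)` is bounded by
`|t| Σ_{u ∼ v} 2 (cosh(φ_u - φ_v) - 1)` (Koma–Tasaki's `‖U‖ ≤ |t| Σ (cosh(φ_x - φ_y) - 1)` with
`‖c†c + h.c.‖` counted as `2`). Koma–Tasaki, PRL 68 (1992) 3248, first bound of eq. (11).
[cite: KomaTasakiPRL1992, eq. (11), first inequality] -/
theorem norm_hoppingPerturbation_le (φ : Λ → ℝ) (t : ℝ) :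
    ‖-(t : ℂ) • hoppingForm G (fun u v => Real.cosh (φ u - φ v) - 1)‖ ≤
      |t| * ∑ u : Λ, ∑ v : Λ, if G.Adj u v then 2 * (Real.cosh (φ u - φ v) - 1) else 0 := by
  rw [norm_smul, norm_neg, Complex.norm_real, Real.norm_eq_abs]
  refine mul_le_mul_of_nonneg_left ((norm_hoppingForm_le G _).trans (le_of_eq ?_)) (abs_nonneg t)
  refine Finset.sum_congr rfl fun u _ => Finset.sum_congr rfl fun v _ => ?_
  split_ifs
  · rw [abs_of_nonneg (sub_nonneg.2 (Real.one_le_cosh _))]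
  · rfl

end Hamiltonian

end Literature.MathematicalPhysics.QuantumLattice
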